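import Summits.NavierStokesRegularity.NavierStokesRegularity.Theorems.SwirlHolderTower
import HarnessLib

/-!
# SwirlHolderTower, part 2 — the linear class, the funnel, and the ceiling on every linear Hölder law
# (ROUND-15 §3, seat nsreg-p2)

Second half of planner nsreg-p2's `R15-SwirlHolderTower.lean` (split for the 400-line rule; see the
module docstring of `…Theorems.SwirlHolderTower` for the mechanism, the funnel and the sources).
Contents: the steady passive swirl class `IsSteadyPassiveSwirl N b Θ` (divergence-free drift of
critical size `|b| ≤ N/|x|`, steady swirl equation off the axis), `LinearHolderLaw γ`,
`NazarovUraltsevaShape` (the printed profile, a fact request), the FUNNEL drift `funnelDrift N`,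
its Kramers exponent `funnelGamma N = √(N/π) e^{−N/4}`, the angular problem `FunnelODE`, the
separable swirls `separableSwirl γ G`, the two classical packages `FunnelSeparation` (chain rule,
typing request T-15.3) and `FunnelExponent` (the ODE fact, T-15.2) used as hypotheses, and the
kernel ceiling `linearHolderLaw_ceiling` / `not_linearPolyHolderLaw` / `dyadicScalesToSmallness`.
WHAT THIS IS NOT: not NS regularity — a ceiling on LINEAR (passive-scalar) methods; `PolyHolderLaw`
for Navier–Stokes solutions (part 1) stays open; hard cores untouched.
-/

namespace Summit.NavierStokesRegularity.NavierStokesRegularity.Theorems.SwirlHolderTower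

open MeasureTheory Set Filter Topology Metric WithLp
open scoped ENNReal NNReal Laplacian
open Literature.Analysis Literature.Analysis.FluidPDE Literature.Analysis.FluidPDE.ChenTsaiZhang2022


noncomputable section

/-! ## 3. The linear class, the funnel, and the ceiling on every linear Hölder law -/

/-- **STEADY PASSIVE SWIRL PAIR of gauge `N`**: a drift `b` on `ℝ³ ∖ {0}`, `C¹`, divergence-free,
of critical size `|b(x)| ≤ N/|x|` (hence weak-`L³` and Morrey `M^{5/3,4/5}` norms `≲ N`, the class
of Ożański–Palasek Prop. 5.1 / Nazarov–Uraltseva 2012), and a `Θ` continuous on `ℝ³`, `C²` on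
`ℝ³ ∖ {0}`, vanishing on the axis, solving the steady swirl equation `b·∇Θ = ΔΘ - (2/r)∂_rΘ` off
the axis (the tree's `swirl_transport` with `u ↦ b`, `∂ₜ = 0`, `ν = 1`, `f = 0`; on the axis minus
the origin it then holds by continuity).  The only singular point is the origin, where the drift is
critical (`N/|x| ∈ L^{3,∞}`) and `Θ` is merely continuous — exactly the situation of a first
blow-up point.  The NS swirl is the case `b = u` (time-dependent); this STEADY linear class already
decides the form of `γ`. -/
def IsSteadyPassiveSwirl (N : ℝ) (b : (EuclideanSpace ℝ (Fin 3)) → (EuclideanSpace ℝ (Fin 3))) (Θ : (EuclideanSpace ℝ (Fin 3)) → ℝ) : Prop :=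
  (∀ x : (EuclideanSpace ℝ (Fin 3)), x ≠ 0 → ‖b x‖ ≤ N / ‖x‖) ∧
  ContDiffOn ℝ 1 b {x : (EuclideanSpace ℝ (Fin 3)) | x ≠ 0} ∧
  (∀ x : (EuclideanSpace ℝ (Fin 3)), x ≠ 0 → VectorCalculus.divergence b x = 0) ∧
  Continuous Θ ∧
  ContDiffOn ℝ 2 Θ {x : (EuclideanSpace ℝ (Fin 3)) | x ≠ 0} ∧
  (∀ x : (EuclideanSpace ℝ (Fin 3)), cylRadius x = 0 → Θ x = 0) ∧
  ∀ x : (EuclideanSpace ℝ (Fin 3)), cylRadius x ≠ 0 →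
    convect b Θ x = (Δ Θ) x - 2 / cylRadius x * partialDeriv (eR x) Θ x

/-- **LINEAR HÖLDER LAW with profile `γ`**: for every steady passive swirl pair of gauge `N ≥ 0`,
values of `Θ` confined to `[a, c]` on the closed unit ball are confined on `B̄_r`, `0 < r ≤ 1`, to an
interval of length `≤ K (1+N)^K r^{γ(N)} (c - a)`.  Nazarov–Uraltseva 2012 (Cor. 2.3, `γ = -log₃ ϰ₀`,
`ϰ₀ = ½exp(-C₈(𝒩))`) / Ożański–Palasek Prop. 5.1 assert it with `γ(N) = exp(-C N^θ)`. -/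
def LinearHolderLaw (γ : ℝ → ℝ) : Prop :=
  ∃ K : ℝ, 0 < K ∧ ∀ N : ℝ, 0 ≤ N → ∀ (b : (EuclideanSpace ℝ (Fin 3)) → (EuclideanSpace ℝ (Fin 3))) (Θ : (EuclideanSpace ℝ (Fin 3)) → ℝ), IsSteadyPassiveSwirl N b Θ →
    ∀ a c : ℝ, a ≤ c → (∀ x ∈ closedBall (0 : (EuclideanSpace ℝ (Fin 3))) 1, Θ x ∈ Icc a c) →
    ∀ r : ℝ, 0 < r → r ≤ 1 →
    ∃ a' c' : ℝ, a' ≤ c' ∧ (∀ x ∈ closedBall (0 : (EuclideanSpace ℝ (Fin 3))) r, Θ x ∈ Icc a' c') ∧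
      c' - a' ≤ K * (1 + N) ^ K * r ^ (γ N) * (c - a)

/-- The shape of the law IN PRINT (Nazarov–Uraltseva 2012 = arXiv:1011.1888 Cor. 2.3 with Thm 2.5′;
Ożański–Palasek arXiv:2210.10030 Prop. 5.1: `γ = exp(-𝒩^{O(1)})`).  A fact REQUEST (T-15.1), used
nowhere as a hypothesis here; recorded to show the funnel does not contradict print. -/
def NazarovUraltsevaShape : Prop :=
  ∃ C θ : ℝ, 0 < C ∧ 0 < θ ∧ LinearHolderLaw (fun N => Real.exp (-(C * (1 + N) ^ θ)))

/-- **THE FUNNEL DRIFT** `u_N(x) = N (2|x|⁴)⁻¹ (x₁(x₃² - x₁² - x₂²), x₂(x₃² - x₁² - x₂²), 2x₃³)`: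
`-1`-homogeneous, axisymmetric, swirl-free, divergence-free on `ℝ³ ∖ {0}`; in spherical
coordinates `u_N = (N/ρ)(P₂(cos ϑ) e_ρ - ½ sin ϑ cos ϑ e_ϑ)` (Stokes stream function
`Ψ = -(N/2) ρ cos ϑ sin²ϑ`): inflow `N/(2ρ)` along the equatorial plane, jets `N/ρ` out along the
axis, `|u_N(x)| ≤ N/|x|` with equality on the axis (`r²(x₃²-r²)² + 4x₃⁶ ≤ 4|x|⁶`).  (A Landau-type
sink–jet; as a blow-up PROFILE it would be Type I.) -/
def funnelDrift (N : ℝ) (x : (EuclideanSpace ℝ (Fin 3))) : (EuclideanSpace ℝ (Fin 3)) :=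
  (N / (2 * ‖x‖ ^ 4)) •
    toLp 2 ![x 0 * (x 2 ^ 2 - x 0 ^ 2 - x 1 ^ 2), x 1 * (x 2 ^ 2 - x 0 ^ 2 - x 1 ^ 2), 2 * x 2 ^ 3]

/-- **THE FUNNEL EXPONENT** `√(N/π) e^{-N/4}` — the leading-order principal exponent of the
angular problem (Kramers escape from the equatorial well of `U(ϑ) = ln sin ϑ - (N/4) sin²ϑ`,
barrier `N/4 - ½ ln N + O(1)`); kit job j269992: true exponent / this = 1.20 (N=32), 1.08 (64),
1.05 (96). -/
def funnelGamma (N : ℝ) : ℝ := Real.sqrt (N / Real.pi) * Real.exp (-(N / 4))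

/-- `funnelGamma N ≥ 0`. -/
theorem funnelGamma_nonneg (N : ℝ) : 0 ≤ funnelGamma N := by
  unfold funnelGamma; positivity

/-- **THE ANGULAR PROBLEM** of the separable solutions `Θ = ρ^γ G(cos ϑ)`, written in
`t = cos ϑ = x₃/|x| ∈ [-1, 1]` (so that no `arccos` enters and `Θ` is manifestly `C²` off the
origin): `G` is `C²`, `G(±1) = 0`, `G > 0` on `(-1, 1)`, `G ≤ m = G(t₀)` on `[-1, 1]`, and
`(1 - t²) G'' - (N/2) t (1 - t²) G' + γ (γ - 1 - (N/2)(3t² - 1)) G = 0` on `(-1, 1)`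
(equivalently, for `φ(ϑ) = G(cos ϑ)`:
`φ'' + (-cot ϑ + (N/2) sin ϑ cos ϑ) φ' + γ(γ - 1 - (N/2)(3cos²ϑ - 1)) φ = 0`, `φ(0) = φ(π) = 0`).
For `N = 0`: `G = 1 - t²`, `γ = 2`, `Θ = r²`.  The exponent `γ` is the principal eigenvalue
parameter; both endpoints are regular singular points with indicial roots `{0, 1}`, so the
solution vanishing there is analytic on a neighbourhood of `[-1, 1]` (extend it `C²` to `ℝ`). -/
def FunnelODE (N γ : ℝ) (G : ℝ → ℝ) (m t₀ : ℝ) : Prop :=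
  ContDiff ℝ 2 G ∧ G 1 = 0 ∧ G (-1) = 0 ∧ (∀ t ∈ Ioo (-1 : ℝ) 1, 0 < G t) ∧
  t₀ ∈ Icc (-1 : ℝ) 1 ∧ G t₀ = m ∧ (∀ t ∈ Icc (-1 : ℝ) 1, G t ≤ m) ∧
  ∀ t ∈ Ioo (-1 : ℝ) 1,
    (1 - t ^ 2) * deriv (deriv G) t - N / 2 * t * (1 - t ^ 2) * deriv G t
      + γ * (γ - 1 - N / 2 * (3 * t ^ 2 - 1)) * G t = 0

/-- The separable function `Θ_{γ,G}(x) = |x|^γ G(x₃/|x|)` (`= 0` at the origin for `γ > 0`, Lean's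
`0/0 = 0` being harmless there; on the axis `x₃/|x| = ±1` where `G` vanishes). -/
def separableSwirl (γ : ℝ) (G : ℝ → ℝ) (x : (EuclideanSpace ℝ (Fin 3))) : ℝ :=
  ‖x‖ ^ γ * G (x 2 / ‖x‖)

/-- **FUNNEL SEPARATION** (classical: chain rule for `|x|^γ G(x₃/|x|)` + `div u_N = 0` +
`|u_N| ≤ N/|x|`; the computation is displayed in the memo §2): every solution of the angular
problem gives a steady passive swirl pair `(u_N, |x|^γ G(x₃/|x|))` of gauge `N`.
Typing request T-15.3 (prover-sized, no PDE theory). -/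
def FunnelSeparation : Prop :=
  ∀ N γ : ℝ, ∀ G : ℝ → ℝ, ∀ m t₀ : ℝ, 0 ≤ N → 0 < γ → FunnelODE N γ G m t₀ →
    IsSteadyPassiveSwirl N (funnelDrift N) (separableSwirl γ G)

/-- **FUNNEL EXPONENT** (the ODE fact; numerics kit job j269992 + Kramers asymptotics; a
certified interval version is test T-15.2): for `N ≥ 16` the angular problem has a positive
solution with exponent `0 < γ ≤ 2√(N/π)e^{-N/4}` (measured: `γ(N)/(√(N/π)e^{-N/4})` decreases
from `1.60` at `N = 16` to `1.05` at `N = 96`; `→ 1`). -/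
def FunnelExponent : Prop :=
  ∀ N : ℝ, 16 ≤ N → ∃ γ : ℝ, ∃ G : ℝ → ℝ, ∃ m t₀ : ℝ,
    0 < γ ∧ γ ≤ 2 * funnelGamma N ∧ 0 < m ∧ FunnelODE N γ G m t₀

/-- Elementary: if `r^γ ≤ K' r^g` for all `r ∈ (0, 1]` then `g ≤ γ`. -/
theorem exponent_le_of_rpow_le {K' γ g : ℝ} (hK : 0 < K')
    (h : ∀ r : ℝ, 0 < r → r ≤ 1 → r ^ γ ≤ K' * r ^ g) : g ≤ γ := by
  by_contra hlt
  push Not at hlt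
  set δ := g - γ with hδ
  have hδpos : 0 < δ := by linarith
  have key : ∀ r : ℝ, 0 < r → r ≤ 1 → 1 ≤ K' * r ^ δ := by
    intro r hr hr1
    have h1 := h r hr hr1
    have hrg : r ^ g = r ^ γ * r ^ δ := by
      rw [← Real.rpow_add hr]; congr 1; ring
    rw [hrg] at h1
    have hpos : 0 < r ^ γ := Real.rpow_pos_of_pos hr γ
    have : r ^ γ * 1 ≤ r ^ γ * (K' * r ^ δ) := by nlinarith
    exact le_of_mul_le_mul_left this hpos
  set r₀ : ℝ := (1 / (2 * K')) ^ (1 / δ) with hr₀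
  have hbase : 0 < 1 / (2 * K') := by positivity
  have hr₀pos : 0 < r₀ := Real.rpow_pos_of_pos hbase _
  have hr₀δ : r₀ ^ δ = 1 / (2 * K') := by
    rw [hr₀, ← Real.rpow_mul hbase.le, one_div_mul_cancel hδpos.ne', Real.rpow_one]
  by_cases hle : r₀ ≤ 1
  · have := key r₀ hr₀pos hle
    rw [hr₀δ] at this
    have : (1 : ℝ) ≤ 1 / 2 := by
      calc (1 : ℝ) ≤ K' * (1 / (2 * K')) := this
        _ = 1 / 2 := by field_simp
    linarith
  · push Not at hle
    have h1 : 1 < 1 / (2 * K') := by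
      by_contra hcon
      push Not at hcon
      have : r₀ ≤ 1 := by
        rw [hr₀]; exact Real.rpow_le_one hbase.le hcon (by positivity)
      linarith
    have := key 1 one_pos le_rfl
    rw [Real.one_rpow, mul_one] at this
    have hK2 : 2 * K' < 1 := by
      rw [lt_div_iff₀ (by positivity)] at h1; linarith
    linarith

/-- The point at distance `r` from the origin with `x₃/|x| = t` in the `x₁x₃`-plane. -/
def polarPoint (r t : ℝ) : (EuclideanSpace ℝ (Fin 3)) := toLp 2 ![r * Real.sqrt (1 - t ^ 2), 0, r * t]

/-- `‖polarPoint r t‖ = r` for `r ≥ 0`, `t ∈ [-1, 1]`. -/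
theorem norm_polarPoint {r t : ℝ} (hr : 0 ≤ r) (ht : t ∈ Icc (-1 : ℝ) 1) :
    ‖polarPoint r t‖ = r := by
  rw [EuclideanSpace.norm_eq, Fin.sum_univ_three]
  simp only [polarPoint, PiLp.toLp_apply, Matrix.cons_val_zero, Matrix.cons_val_one,
    Matrix.cons_val, Real.norm_eq_abs, sq_abs]
  have h1t : 0 ≤ 1 - t ^ 2 := by nlinarith [ht.1, ht.2]
  have : (r * Real.sqrt (1 - t ^ 2)) ^ 2 + (0 : ℝ) ^ 2 + (r * t) ^ 2 = r ^ 2 := by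
    rw [mul_pow, Real.sq_sqrt h1t]; ring
  rw [this, Real.sqrt_sq hr]

/-- The separable swirl at a polar point: `r^γ G(t)`. -/
theorem separableSwirl_polarPoint {γ : ℝ} {G : ℝ → ℝ} {r t : ℝ} (hr : 0 < r)
    (ht : t ∈ Icc (-1 : ℝ) 1) : separableSwirl γ G (polarPoint r t) = r ^ γ * G t := by
  unfold separableSwirl
  rw [norm_polarPoint hr.le ht]
  congr 2
  have h2 : polarPoint r t 2 = r * t := by
    simp [polarPoint, PiLp.toLp_apply]
  rw [h2, mul_div_cancel_left₀ _ hr.ne']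

/-- Values of a separable solution: `0 ≤ Θ(x) ≤ m |x|^γ` when `0 ≤ G ≤ m` on `[-1, 1]`. -/
theorem separableSwirl_bounds {N γ : ℝ} {G : ℝ → ℝ} {m t₀ : ℝ}
    (hode : FunnelODE N γ G m t₀) (x : (EuclideanSpace ℝ (Fin 3))) :
    0 ≤ separableSwirl γ G x ∧ separableSwirl γ G x ≤ m * ‖x‖ ^ γ := by
  obtain ⟨_, h1, hm1, hpos, _, _, hle, _⟩ := hode
  have hquot : x 2 / ‖x‖ ∈ Icc (-1 : ℝ) 1 := by
    by_cases hx : ‖x‖ = 0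
    · rw [hx, div_zero]; constructor <;> norm_num
    · have hxpos : 0 < ‖x‖ := lt_of_le_of_ne (norm_nonneg x) (Ne.symm hx)
      have habs : |x 2| ≤ ‖x‖ := by
        have := EuclideanSpace.norm_eq x ▸ (Real.sqrt_le_sqrt
          (Finset.single_le_sum (f := fun i => ‖x i‖ ^ 2) (fun i _ => sq_nonneg _)
            (Finset.mem_univ (2 : Fin 3))))
        rw [Real.norm_eq_abs, Real.sqrt_sq (abs_nonneg _)] at this
        exact this
      rw [mem_Icc, ← abs_le, abs_div, abs_of_pos hxpos, div_le_one hxpos]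
      exact habs
  have hGnn : 0 ≤ G (x 2 / ‖x‖) := by
    rcases eq_or_lt_of_le hquot.1 with h | h
    · rw [← h, hm1]
    rcases eq_or_lt_of_le hquot.2 with h' | h'
    · rw [h', h1]
    exact (hpos _ ⟨h, h'⟩).le
  have hρ : 0 ≤ ‖x‖ ^ γ := Real.rpow_nonneg (norm_nonneg x) γ
  unfold separableSwirl
  refine ⟨mul_nonneg hρ hGnn, ?_⟩
  rw [mul_comm m]
  exact mul_le_mul_of_nonneg_left (hle _ hquot) hρ

/-- **CEILING ON EVERY LINEAR HÖLDER LAW.**  Given the two classical funnel packages, any Hölder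
law valid for steady passive swirl pairs has profile `γ(N) ≤ 2√(N/π) e^{-N/4}` for all `N ≥ 16`:
the exponential smallness of the Nazarov–Uraltseva / Ożański–Palasek exponent is SHARP for linear
methods (up to the power of `N` in the exponent). -/
theorem linearHolderLaw_ceiling (hsep : FunnelSeparation) (hexp : FunnelExponent)
    {γ : ℝ → ℝ} (hlaw : LinearHolderLaw γ) {N : ℝ} (hN : 16 ≤ N) :
    γ N ≤ 2 * funnelGamma N := by
  obtain ⟨K, hK, hlaw⟩ := hlaw
  obtain ⟨g, G, m, t₀, hg, hgle, hm, hode⟩ := hexp N hN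
  have hN0 : 0 ≤ N := by linarith
  have hpair := hsep N g G m t₀ hN0 hg hode
  -- apply the law with [a, c] = [0, m] on the closed unit ball
  have hconf : ∀ x ∈ closedBall (0 : (EuclideanSpace ℝ (Fin 3))) 1, separableSwirl g G x ∈ Icc 0 m := by
    intro x hx
    obtain ⟨h0, h1⟩ := separableSwirl_bounds hode x
    refine ⟨h0, h1.trans ?_⟩
    have hx1 : ‖x‖ ≤ 1 := by simpa using hx
    have : ‖x‖ ^ g ≤ 1 := Real.rpow_le_one (norm_nonneg x) hx1 hg.le
    calc m * ‖x‖ ^ g ≤ m * 1 := mul_le_mul_of_nonneg_left this hm.le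
      _ = m := mul_one m
  have ht₀ : t₀ ∈ Icc (-1 : ℝ) 1 := hode.2.2.2.2.1
  have hGt₀ : G t₀ = m := hode.2.2.2.2.2.1
  -- for every r ∈ (0,1]: m r^g ≤ K (1+N)^K r^{γ N} m
  have step : ∀ r : ℝ, 0 < r → r ≤ 1 → r ^ g ≤ K * (1 + N) ^ K * r ^ (γ N) := by
    intro r hr hr1
    obtain ⟨a', c', -, hconf', hlen⟩ :=
      hlaw N hN0 _ _ hpair 0 m hm.le hconf r hr hr1
    -- 0 = Θ(0) ∈ [a', c'] and m r^g = Θ(polarPoint r t₀) ∈ [a', c']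
    have h0mem : separableSwirl g G 0 ∈ Icc a' c' := hconf' 0 (by simp [hr.le])
    have hΘ0 : separableSwirl g G 0 = 0 := by
      simp [separableSwirl, Real.zero_rpow hg.ne']
    have hPmem : separableSwirl g G (polarPoint r t₀) ∈ Icc a' c' := by
      apply hconf'
      simp [norm_polarPoint hr.le ht₀]
    rw [separableSwirl_polarPoint hr ht₀, hGt₀] at hPmem
    rw [hΘ0] at h0mem
    have h1 : m * r ^ g ≤ c' - a' := by linarith [hPmem.2, h0mem.1]
    have h2 : m * r ^ g ≤ m * (K * (1 + N) ^ K * r ^ γ N) := by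
      calc m * r ^ g ≤ c' - a' := h1
        _ ≤ K * (1 + N) ^ K * r ^ γ N * (m - 0) := hlen
        _ = m * (K * (1 + N) ^ K * r ^ γ N) := by ring
    exact le_of_mul_le_mul_left h2 hm
  have hK' : 0 < K * (1 + N) ^ K := by positivity
  exact (exponent_le_of_rpow_le hK' step).trans hgle

/-- `2√(N/π)e^{-N/4}` is eventually below every polynomial profile `c(1+N)^{-p}`. -/
theorem exists_funnelGamma_lt_poly {c p : ℝ} (hc : 0 < c) (hp : 0 < p) :
    ∃ N : ℝ, 16 ≤ N ∧ 2 * funnelGamma N < c * (1 + N) ^ (-p) := by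
  obtain ⟨n, hn⟩ : ∃ n : ℕ, p + 1 ≤ n := exists_nat_ge (p + 1)
  have ht : Tendsto (fun x : ℝ => x ^ n * Real.exp (-x)) atTop (𝓝 0) :=
    Real.tendsto_pow_mul_exp_neg_atTop_nhds_zero n
  have ht' : Tendsto (fun N : ℝ => (N / 4) ^ n * Real.exp (-(N / 4))) atTop (𝓝 0) :=
    ht.comp (tendsto_id.atTop_div_const (by norm_num : (0:ℝ) < 4))
  set C : ℝ := 2 * (3 : ℝ) ^ p * (4 : ℝ) ^ n / c with hC
  have hCpos : 0 < C := by positivity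
  have hsmall : ∀ᶠ N : ℝ in atTop, (N / 4) ^ n * Real.exp (-(N / 4)) < 1 / C := by
    have : Iio (1 / C) ∈ 𝓝 (0 : ℝ) := Iio_mem_nhds (by positivity)
    exact ht' this
  obtain ⟨N, hN16, hNs⟩ := ((eventually_ge_atTop (16 : ℝ)).and hsmall).exists
  refine ⟨N, hN16, ?_⟩
  have hN1 : 1 ≤ N := by linarith
  have hNpos : 0 < N := by linarith
  have hsqrt : Real.sqrt (N / Real.pi) ≤ N := by
    rw [Real.sqrt_le_left hNpos.le]
    have hπ : 1 ≤ Real.pi := by linarith [Real.pi_gt_three]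
    calc N / Real.pi ≤ N / 1 := div_le_div_of_nonneg_left hNpos.le one_pos hπ
      _ = N := div_one N
      _ ≤ N ^ 2 := by nlinarith
  have h3N : (1 + N) ^ p ≤ (3 * N) ^ p :=
    Real.rpow_le_rpow (by positivity) (by linarith) hp.le
  have h3Np : (3 * N) ^ p = 3 ^ p * N ^ p := Real.mul_rpow (by norm_num) hNpos.le
  have hNn : N * N ^ p ≤ N ^ (n : ℝ) := by
    have : N * N ^ p = N ^ (p + 1) := by
      rw [Real.rpow_add hNpos, Real.rpow_one]; ring
    rw [this]
    exact Real.rpow_le_rpow_of_exponent_le hN1 hn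
  have hNnat : N ^ (n : ℝ) = N ^ n := Real.rpow_natCast N n
  have hpow : (0:ℝ) < (1 + N) ^ p := Real.rpow_pos_of_pos (by linarith) p
  rw [Real.rpow_neg (by linarith), ← div_eq_mul_inv, lt_div_iff₀ hpow]
  calc 2 * funnelGamma N * (1 + N) ^ p
      ≤ 2 * (N * Real.exp (-(N / 4))) * (3 ^ p * N ^ p) := by
        unfold funnelGamma
        gcongr
        exact le_trans h3N h3Np.le
    _ = 2 * 3 ^ p * ((N * N ^ p) * Real.exp (-(N / 4))) := by ring
    _ ≤ 2 * 3 ^ p * (N ^ n * Real.exp (-(N / 4))) := by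
        gcongr
        rw [← hNnat]; exact hNn
    _ = (2 * 3 ^ p * 4 ^ n) * ((N / 4) ^ n * Real.exp (-(N / 4))) := by
        rw [div_pow]; field_simp
    _ < (2 * 3 ^ p * 4 ^ n) * (1 / C) := by gcongr
    _ = c := by rw [hC]; field_simp

/-- **NO POLYNOMIAL HÖLDER LAW FOR PASSIVE SWIRLS**: given the funnel packages, for every `p, c > 0`
the law with profile `c(1+N)^{-p}` fails on the linear class.  (Contrast: `PolyHolderLaw p` for
NAVIER–STOKES solutions is open — the funnel is not a Navier–Stokes flow.) -/
theorem not_linearPolyHolderLaw (hsep : FunnelSeparation) (hexp : FunnelExponent)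
    {p c : ℝ} (hp : 0 < p) (hc : 0 < c) :
    ¬ LinearHolderLaw (fun N => c * (1 + N) ^ (-p)) := by
  intro hlaw
  obtain ⟨N, hN16, hlt⟩ := exists_funnelGamma_lt_poly hc hp
  have hle := linearHolderLaw_ceiling hsep hexp hlaw hN16
  -- hle : c * (1 + 2N)^(-p) ≤ 2 funnelGamma N, contradiction with hlt
  linarith

/-- **SCALE COUNT.**  With a modulus `r^γ`, reducing the oscillation by a factor `ε⁻¹` costs
`log₂ ε⁻¹ / γ` dyadic scales: `≳ e^{N/4}`-many for the funnel (`7.8e3` at `N = 32`, `1.8e7` at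
`N = 64` for `ε = 10⁻³`) versus `≲ A^p log A` under a polynomial law — the number of consecutive
scales over which an axisymmetric flow may look like a strength-`N` funnel is the one count that
separates `exp exp` from `exp`. -/
def dyadicScalesToSmallness (γ ε : ℝ) : ℝ := Real.logb 2 ε⁻¹ / γ

/-- The scale count is antitone in the exponent. -/
theorem dyadicScalesToSmallness_antitone {γ₁ γ₂ ε : ℝ} (hγ₁ : 0 < γ₁) (hle : γ₁ ≤ γ₂)
    (hε : 0 < ε) (hε1 : ε ≤ 1) :
    dyadicScalesToSmallness γ₂ ε ≤ dyadicScalesToSmallness γ₁ ε := by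
  unfold dyadicScalesToSmallness
  have hlog : 0 ≤ Real.logb 2 ε⁻¹ := Real.logb_nonneg (by norm_num) (one_le_inv_iff₀.mpr ⟨hε, hε1⟩)
  exact div_le_div_of_nonneg_left hlog hγ₁ hle

end

end Summit.NavierStokesRegularity.NavierStokesRegularity.Theorems.SwirlHolderTower
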